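import Summits.AtomisticToContinuum.HydrodynamicLimit.Theses.JaynesSqueeze
import Summits.AtomisticToContinuum.HydrodynamicLimit.Theorems.JaynesSqueezeSqueezeToBlockGibbsBlockSide
import Summits.AtomisticToContinuum.HydrodynamicLimit.Theorems.JaynesSqueezeSqueezeToBlockGibbsUniformBlocks
import Summits.AtomisticToContinuum.HydrodynamicLimit.Theorems.JaynesSqueezeSqueezeToBlockGibbsTimeZeroLimit
import Summits.AtomisticToContinuum.HydrodynamicLimit.Theorems.JaynesSqueezeSqueezeToBlockGibbsPinning
import Summits.AtomisticToContinuum.HydrodynamicLimit.Theorems.TwoClocksClampedWindowDockTimeZero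
import Literature.MathematicalPhysics.KineticTheory.HardSphereEulerLLN
import Literature.Analysis.FunctionSpaces.TorusSpaceTime

/-!
# The squeeze `SqueezeToBlockGibbs` (route JaynesSqueeze): assembly

Closes the support item stmt-AtomisticToContinuum-13463 of route `JaynesSqueeze`:
`theorem squeezeToBlockGibbs_proof : Summit.AtomisticToContinuum.HydrodynamicLimit.Theses.JaynesSqueeze.SqueezeToBlockGibbs`,
i.e. `NoMeanEntropyProduction → MeanBlocksInRange → HardSphereLDA → HsEosLowDensity → DiluteSelfConsistency → BlockGibbs`.

The proof is the squeeze of the item's plan: (i) the exact finite-`N` bookkeeping identity for the relative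
entropy of the evolved local Gibbs law with respect to a block-constant local Gibbs reference (parts I, VI: Liouville
invariance of the fine-grained entropy, log-linearity of the reference density in the one-body block data);
(ii) at the block-matched reference, the uniform local density approximation (parts IV, VII, from `HardSphereLDA` (B)
and the compact ranges of `MeanBlocksInRange`) turns the reference side into the block entropy `𝒮^m_N(s)` of
`NoMeanEntropyProduction`; (iii) the time-zero side converges to `−𝒮[ρ_a, θ₀]` (parts III, VIII, from `HardSphereLDA`
(A)+(B)), and `𝒮[ρ_a, θ₀] = 𝒮[U(0)] = 𝒮[U(s)]` by data pinning (the tree's law of large numbers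
`localGibbs_lln_holds` + uniqueness of limits in probability, part V) and conservation of the thermodynamic entropy
along classical hard-sphere Euler solutions in the dilute band (`PolynomialCompressionEntropy`, packing from
`DiluteSelfConsistency`); (iv) `NoMeanEntropyProduction` closes the squeeze (part VI, `blockGibbs_core`).

References: Jaynes 1965; Csiszár 1975; Ruelle 1969 §3.4; Goldstein–Lebowitz 2004; Yau 1991; Olla–Varadhan–Yau 1993.
-/

noncomputable section

open MeasureTheory Filter Set Topology InformationTheory
open scoped ENNReal

namespace Summit.AtomisticToContinuum.HydrodynamicLimit.Theorems.JaynesSqueezeSqueeze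

open Literature.MathematicalPhysics.KineticTheory Literature.Analysis.FluidPDE
open Literature.Analysis.FunctionSpaces
open MacroClosureLine.StubLedger
open Summit.AtomisticToContinuum.HydrodynamicLimit.Theses.JaynesSqueeze

/-! ## The theorem -/

/-- **`SqueezeToBlockGibbs` (stmt-AtomisticToContinuum-13463).** The squeeze proper of route `JaynesSqueeze`:
`NoMeanEntropyProduction → MeanBlocksInRange → HardSphereLDA → HsEosLowDensity → DiluteSelfConsistency → BlockGibbs`.
See the module docstring for the proof. [folklore] -/
theorem squeezeToBlockGibbs_proof : SqueezeToBlockGibbs := by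
  intro hK1 hR hLDA hEos hDSC a₀ θ₀ u₀ ha hθ hu ha0 hθ0
  classical
  -- statics
  obtain ⟨η₁, hη₁, hLDAσ⟩ := hLDA hEos
  obtain ⟨η₀, hη₀, F, hF, hEq, -, -, -⟩ := hEos
  -- bounds on the data activity
  obtain ⟨Ma, -, hMa⟩ := exists_forall_abs_le_of_continuous ha
  obtain ⟨Mi, -, hMi⟩ := exists_forall_abs_le_of_continuous (ha.inv₀ fun x => (ha0 x).ne')
  set Λ : ℝ := max (max Ma Mi) 1 with hΛ
  have hΛ1 : 1 ≤ Λ := le_max_right _ _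
  have hΛpos : 0 < Λ := by linarith only [hΛ1]
  have haΛ : ∀ x, Λ⁻¹ ≤ a₀ x ∧ a₀ x ≤ Λ := by
    intro x
    constructor
    · rw [inv_le_comm₀ hΛpos (ha0 x)]
      calc (a₀ x)⁻¹ ≤ |(a₀ x)⁻¹| := le_abs_self _
        _ ≤ Mi := hMi x
        _ ≤ Λ := (le_max_right _ _).trans (le_max_left _ _)
    · calc a₀ x ≤ |a₀ x| := le_abs_self _
        _ ≤ Ma := hMa x
        _ ≤ Λ := (le_max_left _ _).trans (le_max_left _ _)
  -- the dynamic hypotheses' thresholds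
  obtain ⟨σK, hσK, ηK, hηK, hK1'⟩ := hK1 a₀ θ₀ u₀ ha hθ hu ha0 hθ0
  obtain ⟨σR, hσR, ηR, hηR, hR'⟩ := hR a₀ θ₀ u₀ ha hθ hu ha0 hθ0
  obtain ⟨σL, hσL, hlln'⟩ := localGibbs_lln_holds a₀ θ₀ u₀ ha hθ hu ha0 hθ0
  set ηD : ℝ := min η₀ η₁ / 4 with hηD
  have hηD0 : 0 < ηD := by positivity
  obtain ⟨σD, hσD, hD'⟩ := hDSC ηD hηD0 a₀ θ₀ u₀ ha hθ hu ha0 hθ0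
  set rA : ℝ := min η₀ η₁ / (4 * Λ ^ 2) with hrA
  have hrA0 : 0 < rA := by positivity
  set σA : ℝ := rA ^ ((1 : ℝ) / 3) with hσA
  have hσA0 : 0 < σA := Real.rpow_pos_of_pos hrA0 _
  set σ₀ : ℝ := min (min (min σK σR) (min σL σD)) (min σA (1 / 2)) with hσ₀
  have hσ₀pos : 0 < σ₀ := by positivity
  refine ⟨σ₀, hσ₀pos, min ηK ηR, lt_min hηK hηR, ?_⟩
  intro σ hσ hσ0 T ρ θ u hE Φ hLLN t ht hguard
  dsimp only
  -- thresholds at this `σ`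
  have hσK' : σ < σK := hσ0.trans_le ((min_le_left _ _).trans ((min_le_left _ _).trans (min_le_left _ _)))
  have hσR' : σ < σR := hσ0.trans_le ((min_le_left _ _).trans ((min_le_left _ _).trans (min_le_right _ _)))
  have hσL' : σ < σL := hσ0.trans_le ((min_le_left _ _).trans ((min_le_right _ _).trans (min_le_left _ _)))
  have hσD' : σ < σD := hσ0.trans_le ((min_le_left _ _).trans ((min_le_right _ _).trans (min_le_right _ _)))
  have hσA' : σ < σA := hσ0.trans_le ((min_le_right _ _).trans (min_le_left _ _))
  have hσ2 : σ ≤ 1 / 2 := (hσ0.trans_le ((min_le_right _ _).trans (min_le_right _ _))).le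
  have hσ3 : σ ^ 3 < rA := pow_three_lt_of_lt_rpow_third hσ.le hrA0.le hσA'
  have hσ3pos : 0 < σ ^ 3 := pow_pos hσ 3
  have hΛσ : 2 * Λ ^ 2 * σ ^ 3 ≤ min η₀ η₁ / 2 := by
    have h1 : 2 * Λ ^ 2 * σ ^ 3 ≤ 2 * Λ ^ 2 * rA := mul_le_mul_of_nonneg_left hσ3.le (by positivity)
    have h2 : 2 * Λ ^ 2 * rA = min η₀ η₁ / 2 := by rw [hrA]; field_simp; ring
    linarith only [h1, h2]
  have hΛσ₁ : 2 * Λ ^ 2 * σ ^ 3 ≤ η₁ := hΛσ.trans ((div_le_self (le_min hη₀.le hη₁.le) (by norm_num)).trans (min_le_right _ _))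
  have hΛσ₀ : 2 * Λ ^ 2 * σ ^ 3 < η₀ := hΛσ.trans_lt ((div_lt_self (lt_min hη₀ hη₁) (by norm_num)).trans_le (min_le_left _ _))
  have hT : 0 < T := ht.1.trans_lt ht.2
  have h0T : (0 : ℝ) ∈ Ico 0 T := ⟨le_rfl, hT⟩
  -- the EOS functions at this `σ`
  set g : ℝ → ℝ := fun r => hsExcessFreeEnergy (r * σ ^ 3) + r * σ ^ 3 * deriv hsExcessFreeEnergy (r * σ ^ 3) with hg
  set ψ : ℝ → ℝ := fun r => r * σ ^ 3 * deriv hsExcessFreeEnergy (r * σ ^ 3) with hψ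
  have hgψ : ∀ r, g r = hsExcessFreeEnergy (r * σ ^ 3) + ψ r := fun r => rfl
  have hψr : ∀ r, r * σ ^ 3 * deriv hsExcessFreeEnergy (r * σ ^ 3) = ψ r := fun r => rfl
  have hgψr : ∀ r, hsExcessFreeEnergy (r * σ ^ 3) + ψ r = g r := fun r => rfl
  have hψζ : ∀ r, ψ r = hsCompressibility (r * σ ^ 3) - 1 := fun r => by simp only [hψ, hsCompressibility]; ring
  obtain ⟨-, hζc, hGc, -, -⟩ := PolynomialCompressionEntropy.hs_eos_data hη₀ hF hEq hσ
  -- continuity of `g, ψ` on the packing range `(0, η₀/σ³)`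
  have hψcJ : ContinuousOn ψ (Ioo 0 (η₀ / σ ^ 3)) := by
    have : ψ = fun r => hsCompressibility (r * σ ^ 3) - 1 := funext hψζ
    rw [this]
    exact hζc.continuousOn.sub continuousOn_const
  have hgcJ : ContinuousOn g (Ioo 0 (η₀ / σ ^ 3)) := by
    have hfc : ContinuousOn (fun r => hsExcessFreeEnergy (r * σ ^ 3)) (Ioo 0 (η₀ / σ ^ 3)) := by
      refine hGc.continuousOn.congr fun r hr => ?_
      exact hEq ⟨(mul_pos hr.1 hσ3pos).le, (lt_div_iff₀ hσ3pos).1 hr.2⟩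
    exact hfc.add hψcJ
  -- static data at time zero: `HardSphereLDA` (A) then (B)
  obtain ⟨hAσ, hBσ⟩ := hLDAσ σ hσ
  have hΛσ₁' : Λ ^ 2 * σ ^ 3 ≤ η₁ := by nlinarith only [hΛσ₁, hΛpos, hσ3pos]
  obtain ⟨ρa, hρam, hρab, hρa1, c, hc⟩ := hAσ Λ hΛ1 hΛσ₁' a₀ ha.measurable haΛ
  simp only [hψr, hgψr] at hc
  have hcl : (0 : ℝ) < (2 * Λ ^ 2)⁻¹ := by positivity
  have hρaσ : ∀ x, (2 * Λ ^ 2)⁻¹ ≤ ρa x ∧ ρa x * σ ^ 3 ≤ η₁ := fun x =>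
    ⟨(hρab x).1, (mul_le_mul_of_nonneg_right (hρab x).2 hσ3pos.le).trans hΛσ₁⟩
  obtain ⟨hZa, -, hmeana⟩ := hBσ _ hcl ρa hρam hρaσ hρa1 u₀ θ₀ hu.measurable hθ.measurable hθ0 Φ
  simp only [hψr, hgψr] at hZa hmeana
  -- the law of large numbers and data pinning
  obtain ⟨ρ₀, hρ₀c, hρ₀p, hllnΦ⟩ := hlln' σ hσ hσL'
  obtain ⟨-, hlln0⟩ := hllnΦ Φ
  obtain ⟨hρ0, -, hθ0eq⟩ := EntropyClockDock.data_eq_of_ties hσ2 Φ ha hθ hu ha0 hθ0 hρ₀c hρ₀p hlln0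
    (hE.smooth_density.isSmooth_slice h0T).continuous (hE.smooth_velocity.isSmooth_slice h0T).continuous
    (hE.smooth_temperature.isSmooth_slice h0T).continuous hLLN
  -- `ρa = ρ₀` almost everywhere: the mean density converges to both
  have hP : ∀ N, IsProbabilityMeasure (localGibbsLaw σ a₀ u₀ θ₀ N (Φ N)) := fun N =>
    isProbabilityMeasure_localGibbsLaw ha hθ hu ha0 hθ0 hσ2 N (Φ N)
  have hlaw : ∀ N, localGibbsLaw σ a₀ u₀ θ₀ N (Φ N) = localGibbsLaw σ (fun x => ρa x * Real.exp (g (ρa x))) u₀ θ₀ N (Φ N) := by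
    intro N
    have e : a₀ = fun x => Real.exp c * (ρa x * Real.exp (g (ρa x))) := by funext x; rw [hc x]; ring
    rw [e]
    exact localGibbsLaw_const_mul (Φ N) _ θ₀ u₀ (Real.exp_pos c)
  have hρaρ₀ : ρa =ᵐ[volume] ρ₀ := by
    have hρaI : Integrable ρa := (integrable_const (2 * Λ ^ 2)).mono' hρam.aestronglyMeasurable
      (Eventually.of_forall fun x => by
        rw [Real.norm_eq_abs, abs_of_nonneg (hcl.le.trans (hρab x).1)]; exact (hρab x).2)
    refine ae_eq_of_forall_integral_mul_eq hρaI (integrable_of_continuous_T3 hρ₀c) (fun x => hcl.le.trans (hρab x).1)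
      (fun x => (hρ₀p x).le) fun χ hχ => ?_
    obtain ⟨C, hC0, hC⟩ := exists_forall_abs_le_of_continuous hχ
    have h1 : Tendsto (fun N : ℕ => ∫ z, empiricalDensityField z χ ∂(localGibbsLaw σ a₀ u₀ θ₀ N (Φ N))) atTop
        (𝓝 (∫ x, χ x * ρa x)) := by simp_rw [hlaw]; exact hmeana χ hχ
    have hbd : |∫ x, χ x * ρ₀ x| ≤ C * ⨆ x, ρ₀ x := by
      obtain ⟨R, -, hR⟩ := exists_forall_abs_le_of_continuous hρ₀c
      have hsup : ∀ x, ρ₀ x ≤ ⨆ y, ρ₀ y := fun x => le_ciSup ⟨R, by rintro _ ⟨y, rfl⟩; exact (le_abs_self _).trans (hR y)⟩ x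
      calc |∫ x, χ x * ρ₀ x| ≤ ∫ x, |χ x * ρ₀ x| := abs_integral_le_integral_abs
        _ ≤ ∫ x, C * ⨆ y, ρ₀ y := by
            refine integral_mono (integrable_of_continuous_T3 (hχ.mul hρ₀c)).abs (integrable_const _) fun x => ?_
            rw [abs_mul, abs_of_pos (hρ₀p x)]
            exact mul_le_mul (hC x) (hsup x) (hρ₀p x).le hC0
        _ = C * ⨆ y, ρ₀ y := by rw [integral_const, smul_eq_mul, probReal_univ, one_mul]
    have h2 : Tendsto (fun N : ℕ => ∫ z, empiricalDensityField z χ ∂(localGibbsLaw σ a₀ u₀ θ₀ N (Φ N))) atTop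
        (𝓝 (∫ x, χ x * ρ₀ x)) := by
      refine tendsto_integral_of_tendsto_measure_gt (Eventually.of_forall hP)
        (X := fun N z => empiricalDensityField z χ) (fun N => ?_) (M := max C (C * ⨆ x, ρ₀ x))
        (fun N z => (abs_empiricalDensityField_le z hC).trans (le_max_left _ _)) (hbd.trans (le_max_right _ _)) ?_
      · simp_rw [empiricalDensityField_eq_sum]
        exact measurable_const.mul (Finset.measurable_sum _ fun i _ => hχ.measurable.comp (measurable_pi_apply i).fst)
      · intro δ hδ
        have h := (hlln0 χ hχ δ hδ).1
        refine h.congr fun N => ?_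
        exact EntropyClockDock.localGibbsLaw_setOf_flow_zero σ a₀ u₀ θ₀ N (Φ N)
          fun z => δ < |empiricalDensityField z χ - ∫ x, χ x * ρ₀ x|
    exact tendsto_nhds_unique h1 h2
  -- the packing on `[0, T)` from `DiluteSelfConsistency`
  have hpackD : ∀ s ∈ Ico 0 T, ∀ x, ρ s x * σ ^ 3 < ηD := hD' σ hσ hσD' T ρ θ u hE Φ hLLN
  have hηD₀ : ηD < η₀ := by
    rw [hηD]; linarith only [min_le_left η₀ η₁, lt_min hη₀ hη₁]
  have hpack₀ : ∀ s ∈ Ico 0 T, ∀ x, ρ s x * σ ^ 3 < η₀ := fun s hs x => (hpackD s hs x).trans hηD₀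
  -- the thermodynamic entropy of the data and its conservation
  set S₀ : ℝ := ∫ x, ρa x * (3 / 2 * Real.log (θ₀ x) - Real.log (ρa x) - hsExcessFreeEnergy (ρa x * σ ^ 3)) with hS₀
  have hSs : ∀ s ∈ Icc 0 t, ∫ x, ρ s x * (3 / 2 * Real.log (θ s x) - Real.log (ρ s x) -
      hsExcessFreeEnergy (ρ s x * σ ^ 3)) = S₀ := by
    intro s hs
    have hsT : s ∈ Ico 0 T := ⟨hs.1, hs.2.trans_lt ht.2⟩
    rw [integral_density_mul_hsEnt_eq hη₀ hF hEq hσ hE hpack₀ hsT, hρ0, hθ0eq, hS₀]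
    refine integral_congr_ae ?_
    filter_upwards [hρaρ₀] with x hx
    rw [hx]
  -- the time-zero term
  have hF_Icc : ContinuousOn F (Icc 0 (2 * Λ ^ 2 * σ ^ 3)) :=
    hF.continuousOn.mono fun η hη => ⟨by linarith [hη.1, hη₀], hη.2.trans_lt hΛσ₀⟩
  have hρaσI : ∀ x, ρa x * σ ^ 3 ∈ Icc 0 (2 * Λ ^ 2 * σ ^ 3) := fun x =>
    ⟨(mul_pos (hcl.trans_le (hρab x).1) hσ3pos).le, mul_le_mul_of_nonneg_right (hρab x).2 hσ3pos.le⟩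
  have hρaσ0 : ∀ x, ρa x * σ ^ 3 ∈ Ico 0 η₀ := fun x => ⟨(hρaσI x).1, (hρaσI x).2.trans_lt hΛσ₀⟩
  obtain ⟨Bf, hBf⟩ := (isCompact_Icc (a := (0 : ℝ)) (b := 2 * Λ ^ 2 * σ ^ 3)).exists_bound_of_continuousOn hF_Icc
  have hfm : Measurable fun x => hsExcessFreeEnergy (ρa x * σ ^ 3) := by
    have : (fun x => hsExcessFreeEnergy (ρa x * σ ^ 3)) = fun x => F (ρa x * σ ^ 3) := funext fun x => hEq (hρaσ0 x)
    rw [this]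
    exact measurable_comp_of_continuousOn hF_Icc (hρam.mul_const _) hρaσI
  have hfb : ∀ x, |hsExcessFreeEnergy (ρa x * σ ^ 3)| ≤ Bf := fun x => by
    rw [hEq (hρaσ0 x)]; simpa [Real.norm_eq_abs] using hBf _ (hρaσI x)
  have hρaJ : ∀ x, ρa x ∈ Icc (2 * Λ ^ 2)⁻¹ (2 * Λ ^ 2) := fun x => hρab x
  have hJsub : Icc (2 * Λ ^ 2)⁻¹ (2 * Λ ^ 2) ⊆ Ioo 0 (η₀ / σ ^ 3) := fun r hr =>
    ⟨hcl.trans_le hr.1, (lt_div_iff₀ hσ3pos).2 (lt_of_le_of_lt (mul_le_mul_of_nonneg_right hr.2 hσ3pos.le) hΛσ₀)⟩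
  have hψcI : ContinuousOn ψ (Icc (2 * Λ ^ 2)⁻¹ (2 * Λ ^ 2)) := hψcJ.mono hJsub
  obtain ⟨Bψ, hBψ⟩ := (isCompact_Icc (a := (2 * Λ ^ 2)⁻¹) (b := 2 * Λ ^ 2)).exists_bound_of_continuousOn hψcI
  have hψm : Measurable fun x => ψ (ρa x) := measurable_comp_of_continuousOn hψcI hρam hρaJ
  have hψb : ∀ x, |ψ (ρa x)| ≤ Bψ := fun x => by simpa [Real.norm_eq_abs] using hBψ _ (hρaJ x)
  have hTZ := tendsto_timeZero_term hσ2 ha hθ hu ha0 hθ0 Φ hρam hcl (fun x => hρab x) hρa1 g ψ hgψ hfm hfb hψm hψb hc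
    hZa hmeana
  -- the ranges of `MeanBlocksInRange` and the parameter bounds `A, Θ, V`
  haveI hne : Nonempty (↥(Icc (0 : ℝ) t) × T3) := ⟨(⟨0, le_rfl, ht.1⟩, 0)⟩
  set rlo : ℝ := (⨅ q : ↥(Icc (0 : ℝ) t) × T3, ρ q.1 q.2) / 2 with hrlo
  set rhi : ℝ := 2 * ⨆ q : ↥(Icc (0 : ℝ) t) × T3, ρ q.1 q.2 with hrhi
  set θlo : ℝ := (⨅ q : ↥(Icc (0 : ℝ) t) × T3, θ q.1 q.2) / 2 with hθlo
  set θhi : ℝ := 2 * ⨆ q : ↥(Icc (0 : ℝ) t) × T3, θ q.1 q.2 with hθhi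
  set V : ℝ := 1 + ⨆ q : ↥(Icc (0 : ℝ) t) × T3, ‖u q.1 q.2‖ with hV
  obtain ⟨cρ, hcρ, hcρle⟩ := exists_pos_le_of_isSmoothSpaceTimeOn hE.smooth_density hE.density_pos ht
  obtain ⟨cθ', hcθ', hcθle⟩ := exists_pos_le_of_isSmoothSpaceTimeOn hE.smooth_temperature hE.temperature_pos ht
  have hinfρ : cρ ≤ ⨅ q : ↥(Icc (0 : ℝ) t) × T3, ρ q.1 q.2 := le_ciInf fun q => hcρle q.1 q.1.2 q.2
  have hinfθ : cθ' ≤ ⨅ q : ↥(Icc (0 : ℝ) t) × T3, θ q.1 q.2 := le_ciInf fun q => hcθle q.1 q.1.2 q.2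
  have hrlo0 : 0 < rlo := by rw [hrlo]; linarith only [hinfρ, hcρ]
  have hθlo0 : 0 < θlo := by rw [hθlo]; linarith only [hinfθ, hcθ']
  have hsupρ : (⨆ q : ↥(Icc (0 : ℝ) t) × T3, ρ q.1 q.2) ≤ ηD / σ ^ 3 := by
    refine ciSup_le fun q => ?_
    rw [le_div_iff₀ hσ3pos]
    exact (hpackD q.1 ⟨q.1.2.1, q.1.2.2.trans_lt ht.2⟩ q.2).le
  have hbddρ : BddAbove (Set.range fun q : ↥(Icc (0 : ℝ) t) × T3 => ρ q.1 q.2) :=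
    ⟨ηD / σ ^ 3, by rintro _ ⟨q, rfl⟩; rw [le_div_iff₀ hσ3pos]; exact (hpackD q.1 ⟨q.1.2.1, q.1.2.2.trans_lt ht.2⟩ q.2).le⟩
  have hlohi : rlo ≤ rhi := by
    have q₀ : ↥(Icc (0 : ℝ) t) × T3 := (⟨0, le_rfl, ht.1⟩, 0)
    have h1 : (⨅ q : ↥(Icc (0 : ℝ) t) × T3, ρ q.1 q.2) ≤ ρ q₀.1 q₀.2 :=
      ciInf_le ⟨0, by rintro _ ⟨q, rfl⟩; exact (hE.density_pos q.1 ⟨q.1.2.1, q.1.2.2.trans_lt ht.2⟩ q.2).le⟩ q₀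
    have h2 : ρ q₀.1 q₀.2 ≤ ⨆ q : ↥(Icc (0 : ℝ) t) × T3, ρ q.1 q.2 := le_ciSup hbddρ q₀
    have h3 : 0 ≤ ρ q₀.1 q₀.2 := (hE.density_pos q₀.1 ⟨q₀.1.2.1, q₀.1.2.2.trans_lt ht.2⟩ q₀.2).le
    rw [hrlo, hrhi]; linarith only [h1, h2, h3]
  have hrhiσ : rhi * σ ^ 3 ≤ 2 * ηD := by
    rw [hrhi]
    have := mul_le_mul_of_nonneg_right hsupρ hσ3pos.le
    rw [div_mul_cancel₀ _ hσ3pos.ne'] at this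
    linarith only [this]
  have hrhi₁ : rhi * σ ^ 3 ≤ η₁ := hrhiσ.trans (by
    rw [hηD]; linarith only [min_le_right η₀ η₁, lt_min hη₀ hη₁])
  have hrhi₀ : rhi * σ ^ 3 < η₀ := hrhiσ.trans_lt (by
    rw [hηD]; linarith only [min_le_left η₀ η₁, lt_min hη₀ hη₁])
  have hIsub : Icc rlo rhi ⊆ Ioo 0 (η₀ / σ ^ 3) := fun r hr =>
    ⟨hrlo0.trans_le hr.1, (lt_div_iff₀ hσ3pos).2 ((mul_le_mul_of_nonneg_right hr.2 hσ3pos.le).trans_lt hrhi₀)⟩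
  have hgc : ContinuousOn g (Icc rlo rhi) := hgcJ.mono hIsub
  have hψc : ContinuousOn ψ (Icc rlo rhi) := hψcJ.mono hIsub
  obtain ⟨gB, hgB'⟩ := (isCompact_Icc (a := rlo) (b := rhi)).exists_bound_of_continuousOn hgc
  have hgB : ∀ r ∈ Icc rlo rhi, |g r| ≤ gB := fun r hr => by simpa [Real.norm_eq_abs] using hgB' r hr
  have hV0 : 0 ≤ V := by
    rw [hV]
    have : 0 ≤ ⨆ q : ↥(Icc (0 : ℝ) t) × T3, ‖u q.1 q.2‖ := Real.iSup_nonneg fun q => norm_nonneg _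
    linarith only [this]
  set A : ℝ := max 1 (max (rhi * Real.exp gB) (rlo * Real.exp (-gB))⁻¹) with hA
  set Θ : ℝ := max 1 (max θhi θlo⁻¹) with hΘ
  have hA1 : 1 ≤ A := le_max_left _ _
  have hΘ1 : 1 ≤ Θ := le_max_left _ _
  have hApos : 0 < A := by linarith only [hA1]
  have hΘpos : 0 < Θ := by linarith only [hΘ1]
  have hAlo : A⁻¹ ≤ rlo * Real.exp (-gB) := by
    rw [inv_le_comm₀ hApos (mul_pos hrlo0 (Real.exp_pos _))]
    exact (le_max_right _ _).trans (le_max_right _ _)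
  have hAhi : rhi * Real.exp gB ≤ A := (le_max_left _ _).trans (le_max_right _ _)
  have hΘlo : Θ⁻¹ ≤ θlo := by
    rw [inv_le_comm₀ hΘpos hθlo0]
    exact (le_max_right _ _).trans (le_max_right _ _)
  have hΘhi : θhi ≤ Θ := (le_max_left _ _).trans (le_max_right _ _)
  -- the pointwise local density approximation in configurational form, for `uniform_blockLDA`
  have hBpos : ∀ ρ₁ : T3 → ℝ, Measurable ρ₁ → (∀ x, rlo ≤ ρ₁ x ∧ ρ₁ x ≤ rhi) → ∫ x, ρ₁ x = 1 →
      Tendsto (fun N : ℕ => ((N : ℝ) + 1)⁻¹ *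
        Real.log (posPartition (fun x => ρ₁ x * Real.exp (g (ρ₁ x))) (hsDiameter σ N) (N + 1))) atTop
        (𝓝 (∫ x, ρ₁ x * ψ (ρ₁ x))) := by
    intro ρ₁ hρ₁m hρ₁b hρ₁1
    have hρ₁σ : ∀ x, rlo ≤ ρ₁ x ∧ ρ₁ x * σ ^ 3 ≤ η₁ := fun x =>
      ⟨(hρ₁b x).1, (mul_le_mul_of_nonneg_right (hρ₁b x).2 hσ3pos.le).trans hrhi₁⟩
    obtain ⟨h, -, -⟩ := hBσ rlo hrlo0 ρ₁ hρ₁m hρ₁σ hρ₁1 (fun _ => (0 : V3)) (fun _ => (1 : ℝ)) measurable_const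
      measurable_const (fun _ => one_pos) Φ
    simp only [hψr, hgψr] at h
    have ham : Measurable fun x => ρ₁ x * Real.exp (g (ρ₁ x)) :=
      hρ₁m.mul (Real.measurable_exp.comp (measurable_comp_of_continuousOn hgc hρ₁m fun x => hρ₁b x))
    have hZeq : ∀ N : ℕ, canonicalPartition (Torus.geometry (Fin 3)) (hsDiameter σ N) (N + 1)
        (localGibbsProfile (fun x => ρ₁ x * Real.exp (g (ρ₁ x))) (fun _ => (0 : V3)) (fun _ => (1 : ℝ))) =
        posPartition (fun x => ρ₁ x * Real.exp (g (ρ₁ x))) (hsDiameter σ N) (N + 1) := fun N =>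
      canonicalPartition_eq_posPartition_of_pos ham measurable_const measurable_const
        (fun x => mul_pos (hrlo0.trans_le (hρ₁b x).1) (Real.exp_pos _)) (fun _ => one_pos) _ _
    simp_rw [hZeq] at h
    exact h
  -- `K1` and `R` at this solution
  have hguardK : ∀ s ∈ Icc 0 t, ∀ x, ρ s x * σ ^ 3 ≤ ηK := fun s hs x => (hguard s hs x).trans (min_le_left _ _)
  have hguardR : ∀ s ∈ Icc 0 t, ∀ x, ρ s x * σ ^ 3 ≤ ηR := fun s hs x => (hguard s hs x).trans (min_le_right _ _)
  have hK1N := hK1' σ hσ hσK' T ρ θ u hE Φ hLLN t ht hguardK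
  have hRN := hR' σ hσ hσR' T ρ θ u hE Φ hLLN t ht hguardR
  dsimp only at hK1N hRN
  refine ⟨A, Θ, V, hApos, hΘpos, fun δ hδ => ?_⟩
  have hδ4 : 0 < δ / 4 := by positivity
  obtain ⟨m₁, hm₁⟩ := hK1N (δ / 4) hδ4
  obtain ⟨m₂, hm₂⟩ := hRN
  refine ⟨max (max m₁ m₂) 1, fun m hm => ?_⟩
  have hm0 : 0 < m := lt_of_lt_of_le one_pos ((le_max_right _ _).trans hm)
  have hmK := hm₁ m ((le_max_left _ _).trans ((le_max_left _ _).trans hm))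
  have hmR := hm₂ m ((le_max_right _ _).trans ((le_max_left _ _).trans hm))
  have hU := uniform_blockLDA hσ2 hm0 g ψ hrlo0 hlohi hgc hψc hBpos hδ4
  have hT0 := (Metric.tendsto_nhds.1 hTZ) (δ / 4) hδ4
  filter_upwards [hmK, hmR, hU, hT0] with N hKN hRN' hUN hTN
  intro s hs
  -- the block masses at `(N, s)` as block values
  haveI : IsProbabilityMeasure ((Φ N).lawAt (localGibbsLaw σ a₀ u₀ θ₀ N (Φ N)) s) := by
    rw [HardSphereFlow.lawAt_eq]; exact Measure.isProbabilityMeasure_map ((Φ N).measurable_flow s).aemeasurable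
  have hsum := sum_blockMass_eq_one ((Φ N).lawAt (localGibbsLaw σ a₀ u₀ θ₀ N (Φ N)) s) hm0
  have hRs := hRN' s hs
  set mass : (Fin 3 → ℕ) → ℝ := fun k => ((((((N : ℝ≥0∞) + 1)⁻¹ • Measure.sum fun i : Fin (N + 1) =>
    ((Φ N).lawAt (localGibbsLaw σ a₀ u₀ θ₀ N (Φ N)) s).map fun z => z i).restrict
    ({x : T3 | (fun i => ⌊(m : ℝ) * Torus.repr x i⌋₊) = k} ×ˢ (univ : Set V3))).snd) univ).toReal with hmass_def
  have hw : ∑ j : ↥(Fintype.piFinset fun _ : Fin 3 => Finset.range m), ((m : ℝ)⁻¹) ^ 3 * ((m : ℝ) ^ 3 * mass j) = 1 := by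
    rw [← hsum, ← Finset.sum_coe_sort (Fintype.piFinset fun _ : Fin 3 => Finset.range m)]
    refine Finset.sum_congr rfl fun j _ => ?_
    have hm0' : (m : ℝ) ≠ 0 := by exact_mod_cast hm0.ne'
    simp only [hmass_def]
    field_simp
  have hTIs : |(∫ z, (∫ y, Real.log (localGibbsProfile a₀ u₀ θ₀ y) ∂(empiricalMeasure z))
        ∂(localGibbsLaw σ a₀ u₀ θ₀ N (Φ N))) -
      ((N : ℝ) + 1)⁻¹ * Real.log (canonicalPartition (Torus.geometry (Fin 3)) (hsDiameter σ N) (N + 1)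
        (localGibbsProfile a₀ u₀ θ₀)) - (-S₀ - 3 / 2 - 3 / 2 * Real.log (2 * Real.pi))| ≤ δ / 4 := by
    have h := hTN
    rw [Real.dist_eq] at h
    exact h.le
  -- the core estimate
  obtain ⟨ca, cθ, cu, hb, hkl⟩ := blockGibbs_core hσ2 N (Φ N) ha hθ hu ha0 hθ0 hm0 s g ψ hgψ hrlo0 hlohi hgB hθlo0 hV0
    hA1 hAlo hAhi hΘ1 hΘlo hΘhi mass _ _ (fun k => rfl) (fun k => rfl) hRs (S₀ := S₀) (δ₁ := δ / 4) (δ₂ := δ / 4)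
    (δ₃ := δ / 4) (hK1 := by rw [← hSs s hs]; exact hKN s hs) (hTI := hTIs)
    (hLDA := hUN (fun j => (m : ℝ) ^ 3 * mass j) (fun j => ⟨(hRs j j.2).1, (hRs j j.2).2.1⟩) hw)
  refine ⟨ca, cθ, cu, hb, hkl.trans (ENNReal.ofReal_le_ofReal ?_)⟩
  exact mul_le_mul_of_nonneg_right (by linarith only [hδ]) (by positivity)

end Summit.AtomisticToContinuum.HydrodynamicLimit.Theorems.JaynesSqueezeSqueeze

end
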